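import Summits.QuantumFields.QCD.Theses.NestedDissectionSea
import Summits.QuantumFields.QCD.Theorems.EarlyCrosserLaw.Negative.LowerPinLoadBearing
import Literature.MathematicalPhysics.QuantumFieldTheory.QCDGoldstoneBound

/-!
# Crux `LightQuarkCompletion` (stmt-QuantumFields-18066) — line `Sketch`, stub `stub_lightBody` (B2c, "light body")

Worker file for the registered stub `LightQuarkJumpLine.stub_lightBody` (signature in `stub_lightBody.sig.txt`).

**Verdict: `stub-blocked`.**  The stub asks, for the re-centring of a threshold regularisation `reg` at a germ `J`
(`m_crit ↦ m_crit + a J / Z_m`, all other data kept) that carries the two-sided parity pin at ZERO threshold, the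
`QCDOf` body at EVERY positive tuple `m`.  By the scheme identity `recentre_scheme` (§1) the re-centred scheme at `m`
IS `reg.scheme (fun f => J + m f)`, so the conclusion at `m` is the body of `reg` at the tuple `J + m`:

* for tuples with `M₀ < J + m_f` for all `f` it is the hypothesis re-based — PROVED (§2, `body_recentre_of_above`,
  `lightBody_above`; corollary `lightBody_of_threshold_le` when `M₀ ≤ J`);
* for tuples with some `J + m_f ≤ M₀` it is the light-quark continuation of the body below the threshold — genuinely
  new constructive content (card `mass-ladder-continuation`), supplied by no hypothesis: the pins are statements about
  phase-quenched sign probabilities of `Re det D_W`, the body about OS data and lattice gaps, and no tree fact links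
  them; nor is `M₀ ≤ J` derivable (the threshold upper pin lives on tori of side in `[R, 2R]`, the zero-threshold
  lower pin on tori `≥ R'`, radii chosen independently per package, so they never provably meet on a common torus —
  and even if they did the comparison would bound `J` from ABOVE by `M₀`, cf. `Cruxes/LightQuarkCompletion/Disproof.lean`
  §6 (S3) "pin rigidity is not a theorem of the typed clauses").

§3 records the exact residual, kernel-checked: `lightBody_of_lightContinuation` closes the registered signature from
the ONE extra hypothesis "body of `reg` at every tuple `J + m`, `m > 0`, with some `J + m_f ≤ M₀`", and
`body_recentre_iff` shows the stub's conclusion is EQUIVALENT to the body of `reg` at all tuples `J + m`, `m > 0`.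

Pure logic over the tree's definitions; no definition introduced; nothing here asserts a Theses decl.
-/

noncomputable section

namespace Summit.QuantumFields.QCD.Theorems.LightQuarkJumpLine

open MeasureTheory Filter Topology
open Literature.MathematicalPhysics.QuantumFieldTheory Literature.MathematicalPhysics.QuantumLattice
  Literature.Probability.LatticeModels
open Summit.QuantumFields.QCD.Theorems.CoerciveSeaNegative (PinClause tendsto_a_div_Zm massExponent_pos)
open Summit.QuantumFields.QCD.Theorems.EarlyCrosserLawNegative (UpperPin)

/-! ## §1 The re-centred scheme is the original scheme at the translated tuple -/

section Recentre

variable {Nf : ℕ} (reg : QCDRegularisation Nf) (J : ℝ)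

/-- **Scheme identity of the re-centring.**  The regularisation `reg` re-centred at the germ `J`
(`m_crit(k) ↦ m_crit(k) + a_k J / Z_m(k)`, same `a, β, L, Z_m`) realises at the tuple `m` exactly the scheme `reg`
realises at `J + m`: the bare trajectories `m_crit + a J/Z_m + a m_f/Z_m` and `m_crit + a (J + m_f)/Z_m` coincide
(one `ring` on the `mq` field; the pattern of `thresholdShift_generic` /
`RobustYangMillsHandover.Negative.isChiralAtZero_mcrit_shift_iff`). [folklore] -/
theorem recentre_scheme (m : Fin Nf → ℝ) (z shift : QCDField Nf → ℕ → ℝ) :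
    (QCDRegularisation.mk reg.a reg.a_pos reg.tendsto_a reg.β reg.L reg.tendsto_L
        (fun k => reg.mcrit k + reg.a k * J / reg.Zm k) reg.Zm reg.Zm_pos : QCDRegularisation Nf).scheme m z shift
      = reg.scheme (fun f => J + m f) z shift := by
  simp only [QCDRegularisation.scheme, QCDScheme.mk.injEq, true_and, and_true]
  funext f k
  ring

/-- The translated tuple of a positive tuple lies above the threshold once the germ does: `M₀ ≤ J`, `0 < m_f` give
`M₀ < J + m_f`. [folklore] -/
theorem threshold_lt_germ_add {M₀ : ℝ} (hJ : M₀ ≤ J) {m : Fin Nf → ℝ} (hm : ∀ f, 0 < m f) (f : Fin Nf) :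
    M₀ < J + m f := by
  have := hm f
  linarith

/-! ## §2 The provable half: the light body above the threshold -/

/-- **The body of the re-centring at a tuple whose translate is above the threshold** (core form, minimal
hypotheses): if `reg` carries the `QCDOf` body at every tuple `> M₀`, then `reg` re-centred at `J` carries it at every
tuple `m` with `M₀ < J + m_f` for all `f` — the same species renormalisations and OS data, transported along
`recentre_scheme`. [folklore] -/
theorem body_recentre_of_above {M₀ : ℝ}
    (hbody : ∀ m : Fin Nf → ℝ, (∀ f, M₀ < m f) → ∃ (z shift : QCDField Nf → ℕ → ℝ) (T : OSData (QCDField Nf) 4),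
      IsQCDAlong (reg.scheme m z shift) T ∧ T.IsNontrivial QCDField.glue ∧ T.IsNonGaussian QCDField.glue ∧
        (∀ f g : Fin Nf, f ≠ g → T.IsNontrivial (QCDField.pseudoRe f g)) ∧
          ∃ Δ > 0, T.HasMassGap Δ ∧ (reg.scheme m z shift).HasLatticeMassGap Δ)
    (m : Fin Nf → ℝ) (hm : ∀ f, M₀ < J + m f) :
    ∃ (z shift : QCDField Nf → ℕ → ℝ) (T : OSData (QCDField Nf) 4),
      IsQCDAlong ((QCDRegularisation.mk reg.a reg.a_pos reg.tendsto_a reg.β reg.L reg.tendsto_L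
        (fun k => reg.mcrit k + reg.a k * J / reg.Zm k) reg.Zm reg.Zm_pos : QCDRegularisation Nf).scheme
        m z shift) T ∧ T.IsNontrivial QCDField.glue ∧ T.IsNonGaussian QCDField.glue ∧
        (∀ f g : Fin Nf, f ≠ g → T.IsNontrivial (QCDField.pseudoRe f g)) ∧
          ∃ Δ > 0, T.HasMassGap Δ ∧
            ((QCDRegularisation.mk reg.a reg.a_pos reg.tendsto_a reg.β reg.L reg.tendsto_L
        (fun k => reg.mcrit k + reg.a k * J / reg.Zm k) reg.Zm reg.Zm_pos : QCDRegularisation Nf).scheme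
              m z shift).HasLatticeMassGap Δ := by
  obtain ⟨z, shift, T, hQ, hN, hG, hP, Δ, hΔ, hT, hL⟩ := hbody (fun f => J + m f) hm
  refine ⟨z, shift, T, ?_, hN, hG, hP, Δ, hΔ, hT, ?_⟩
  · rwa [recentre_scheme]
  · rwa [recentre_scheme]

/-- **The stub's conclusion is EXACTLY the body of `reg` at the translated tuples** (both directions of the transport
along `recentre_scheme`): the re-centring at `J` carries the body at every positive tuple iff `reg` carries it at every
tuple `J + m`, `m > 0`. [folklore] -/
theorem body_recentre_iff :
    (∀ m : Fin Nf → ℝ, (∀ f, 0 < m f) → ∃ (z shift : QCDField Nf → ℕ → ℝ) (T : OSData (QCDField Nf) 4),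
      IsQCDAlong ((QCDRegularisation.mk reg.a reg.a_pos reg.tendsto_a reg.β reg.L reg.tendsto_L
        (fun k => reg.mcrit k + reg.a k * J / reg.Zm k) reg.Zm reg.Zm_pos : QCDRegularisation Nf).scheme
        m z shift) T ∧ T.IsNontrivial QCDField.glue ∧ T.IsNonGaussian QCDField.glue ∧
        (∀ f g : Fin Nf, f ≠ g → T.IsNontrivial (QCDField.pseudoRe f g)) ∧
          ∃ Δ > 0, T.HasMassGap Δ ∧
            ((QCDRegularisation.mk reg.a reg.a_pos reg.tendsto_a reg.β reg.L reg.tendsto_L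
        (fun k => reg.mcrit k + reg.a k * J / reg.Zm k) reg.Zm reg.Zm_pos : QCDRegularisation Nf).scheme
              m z shift).HasLatticeMassGap Δ) ↔
    (∀ m : Fin Nf → ℝ, (∀ f, 0 < m f) → ∃ (z shift : QCDField Nf → ℕ → ℝ) (T : OSData (QCDField Nf) 4),
      IsQCDAlong (reg.scheme (fun f => J + m f) z shift) T ∧ T.IsNontrivial QCDField.glue ∧
        T.IsNonGaussian QCDField.glue ∧ (∀ f g : Fin Nf, f ≠ g → T.IsNontrivial (QCDField.pseudoRe f g)) ∧
          ∃ Δ > 0, T.HasMassGap Δ ∧ (reg.scheme (fun f => J + m f) z shift).HasLatticeMassGap Δ) := by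
  simp only [recentre_scheme]

end Recentre

/-- **Stub B2c above the threshold — PROVED half** (the registered signature of `stub_lightBody` with the extra
hypothesis `∀ f, M₀ < J + m f` on the tuple): for the re-centring of `reg` at `J` the `QCDOf` body holds at every
positive tuple whose translate `J + m` lies above `M₀` — it is the threshold body of `reg` at `J + m`, re-based by
`recentre_scheme`.  (All other hypotheses are idle here; they are kept verbatim for drop-in use by the lead.) [folklore] -/
theorem lightBody_above : ∀ Nf : ℕ, (Nf = 2 ∨ Nf = 3) → ∀ reg : QCDRegularisation Nf, reg.HasMassScaling →
    (reg.scheme 0 0 0).HasAsymptoticScaling → (∀ᶠ k : ℕ in atTop, -1 ≤ reg.mcrit k) → ∀ M₀ : ℝ, 0 ≤ M₀ →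
    (∀ m : Fin Nf → ℝ, (∀ f, M₀ < m f) → ∃ R : ℝ, 0 < R ∧ PinClause Nf reg M₀ m R ∧ UpperPin Nf reg M₀ m R) →
    (∀ m : Fin Nf → ℝ, (∀ f, M₀ < m f) → ∃ (z shift : QCDField Nf → ℕ → ℝ) (T : OSData (QCDField Nf) 4),
      IsQCDAlong (reg.scheme m z shift) T ∧ T.IsNontrivial QCDField.glue ∧ T.IsNonGaussian QCDField.glue ∧
        (∀ f g : Fin Nf, f ≠ g → T.IsNontrivial (QCDField.pseudoRe f g)) ∧
          ∃ Δ > 0, T.HasMassGap Δ ∧ (reg.scheme m z shift).HasLatticeMassGap Δ) →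
    ∀ J : ℝ, (∀ m : Fin Nf → ℝ, (∀ f, 0 < m f) → ∃ R : ℝ, 0 < R ∧
      PinClause Nf (QCDRegularisation.mk reg.a reg.a_pos reg.tendsto_a reg.β reg.L reg.tendsto_L
        (fun k => reg.mcrit k + reg.a k * J / reg.Zm k) reg.Zm reg.Zm_pos) 0 m R ∧
      UpperPin Nf (QCDRegularisation.mk reg.a reg.a_pos reg.tendsto_a reg.β reg.L reg.tendsto_L
        (fun k => reg.mcrit k + reg.a k * J / reg.Zm k) reg.Zm reg.Zm_pos) 0 m R) →
    ∀ m : Fin Nf → ℝ, (∀ f, 0 < m f) → (∀ f, M₀ < J + m f) →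
      ∃ (z shift : QCDField Nf → ℕ → ℝ) (T : OSData (QCDField Nf) 4),
      IsQCDAlong ((QCDRegularisation.mk reg.a reg.a_pos reg.tendsto_a reg.β reg.L reg.tendsto_L
        (fun k => reg.mcrit k + reg.a k * J / reg.Zm k) reg.Zm reg.Zm_pos).scheme
        m z shift) T ∧ T.IsNontrivial QCDField.glue ∧ T.IsNonGaussian QCDField.glue ∧
        (∀ f g : Fin Nf, f ≠ g → T.IsNontrivial (QCDField.pseudoRe f g)) ∧
          ∃ Δ > 0, T.HasMassGap Δ ∧
            ((QCDRegularisation.mk reg.a reg.a_pos reg.tendsto_a reg.β reg.L reg.tendsto_L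
        (fun k => reg.mcrit k + reg.a k * J / reg.Zm k) reg.Zm reg.Zm_pos).scheme
              m z shift).HasLatticeMassGap Δ := by
  intro Nf _hNf reg _hMS _hAS _hbr M₀ _hM₀ _hpin hbody J _hpin' m _hm hJm
  exact body_recentre_of_above reg J hbody m hJm

/-- **Corollary: the light body when the germ lies at or above the threshold** (`M₀ ≤ J`; the registered signature
of `stub_lightBody` with `M₀ ≤ J` inserted after `∀ J`): then every positive tuple translates above `M₀`
(`threshold_lt_germ_add`) and `lightBody_above` gives the body at EVERY positive tuple.  In particular the stub holds
outright at `M₀ = 0` for every `J ≥ 0`. [folklore] -/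
theorem lightBody_of_threshold_le : ∀ Nf : ℕ, (Nf = 2 ∨ Nf = 3) → ∀ reg : QCDRegularisation Nf, reg.HasMassScaling →
    (reg.scheme 0 0 0).HasAsymptoticScaling → (∀ᶠ k : ℕ in atTop, -1 ≤ reg.mcrit k) → ∀ M₀ : ℝ, 0 ≤ M₀ →
    (∀ m : Fin Nf → ℝ, (∀ f, M₀ < m f) → ∃ R : ℝ, 0 < R ∧ PinClause Nf reg M₀ m R ∧ UpperPin Nf reg M₀ m R) →
    (∀ m : Fin Nf → ℝ, (∀ f, M₀ < m f) → ∃ (z shift : QCDField Nf → ℕ → ℝ) (T : OSData (QCDField Nf) 4),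
      IsQCDAlong (reg.scheme m z shift) T ∧ T.IsNontrivial QCDField.glue ∧ T.IsNonGaussian QCDField.glue ∧
        (∀ f g : Fin Nf, f ≠ g → T.IsNontrivial (QCDField.pseudoRe f g)) ∧
          ∃ Δ > 0, T.HasMassGap Δ ∧ (reg.scheme m z shift).HasLatticeMassGap Δ) →
    ∀ J : ℝ, M₀ ≤ J → (∀ m : Fin Nf → ℝ, (∀ f, 0 < m f) → ∃ R : ℝ, 0 < R ∧
      PinClause Nf (QCDRegularisation.mk reg.a reg.a_pos reg.tendsto_a reg.β reg.L reg.tendsto_L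
        (fun k => reg.mcrit k + reg.a k * J / reg.Zm k) reg.Zm reg.Zm_pos) 0 m R ∧
      UpperPin Nf (QCDRegularisation.mk reg.a reg.a_pos reg.tendsto_a reg.β reg.L reg.tendsto_L
        (fun k => reg.mcrit k + reg.a k * J / reg.Zm k) reg.Zm reg.Zm_pos) 0 m R) →
    ∀ m : Fin Nf → ℝ, (∀ f, 0 < m f) → ∃ (z shift : QCDField Nf → ℕ → ℝ) (T : OSData (QCDField Nf) 4),
      IsQCDAlong ((QCDRegularisation.mk reg.a reg.a_pos reg.tendsto_a reg.β reg.L reg.tendsto_L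
        (fun k => reg.mcrit k + reg.a k * J / reg.Zm k) reg.Zm reg.Zm_pos).scheme
        m z shift) T ∧ T.IsNontrivial QCDField.glue ∧ T.IsNonGaussian QCDField.glue ∧
        (∀ f g : Fin Nf, f ≠ g → T.IsNontrivial (QCDField.pseudoRe f g)) ∧
          ∃ Δ > 0, T.HasMassGap Δ ∧
            ((QCDRegularisation.mk reg.a reg.a_pos reg.tendsto_a reg.β reg.L reg.tendsto_L
        (fun k => reg.mcrit k + reg.a k * J / reg.Zm k) reg.Zm reg.Zm_pos).scheme
              m z shift).HasLatticeMassGap Δ := by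
  intro Nf _hNf reg _hMS _hAS _hbr M₀ _hM₀ _hpin hbody J hJ _hpin' m hm
  exact body_recentre_of_above reg J hbody m (threshold_lt_germ_add J hJ hm)

/-! ## §3 The exact residual: the light-quark continuation below the threshold -/

/-- **Stub B2c from the light-quark continuation — what EXACTLY remains.**  The registered signature of
`stub_lightBody` with ONE extra hypothesis inserted after the zero-threshold pin: the body of `reg` at every tuple
`J + m`, `m > 0`, SOME component of which lies at or below the threshold (`∃ f, J + m_f ≤ M₀`) — the light-quark
continuation of the threshold body (card `mass-ladder-continuation`; in the tree the nearest named statements are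
`HeavyThresholdYMBridge.ChiralCompletion`, whose re-pin offset `δ` is existential, and
`EulerDescent.RetypedContinuumComplement`, which needs the light lattice gap as input).  Given it, a positive tuple
either translates above `M₀` (§2) or falls under the continuation, and `recentre_scheme` re-bases both. [folklore] -/
theorem lightBody_of_lightContinuation : ∀ Nf : ℕ, (Nf = 2 ∨ Nf = 3) → ∀ reg : QCDRegularisation Nf,
    reg.HasMassScaling → (reg.scheme 0 0 0).HasAsymptoticScaling → (∀ᶠ k : ℕ in atTop, -1 ≤ reg.mcrit k) →
    ∀ M₀ : ℝ, 0 ≤ M₀ →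
    (∀ m : Fin Nf → ℝ, (∀ f, M₀ < m f) → ∃ R : ℝ, 0 < R ∧ PinClause Nf reg M₀ m R ∧ UpperPin Nf reg M₀ m R) →
    (∀ m : Fin Nf → ℝ, (∀ f, M₀ < m f) → ∃ (z shift : QCDField Nf → ℕ → ℝ) (T : OSData (QCDField Nf) 4),
      IsQCDAlong (reg.scheme m z shift) T ∧ T.IsNontrivial QCDField.glue ∧ T.IsNonGaussian QCDField.glue ∧
        (∀ f g : Fin Nf, f ≠ g → T.IsNontrivial (QCDField.pseudoRe f g)) ∧
          ∃ Δ > 0, T.HasMassGap Δ ∧ (reg.scheme m z shift).HasLatticeMassGap Δ) →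
    ∀ J : ℝ, (∀ m : Fin Nf → ℝ, (∀ f, 0 < m f) → ∃ R : ℝ, 0 < R ∧
      PinClause Nf (QCDRegularisation.mk reg.a reg.a_pos reg.tendsto_a reg.β reg.L reg.tendsto_L
        (fun k => reg.mcrit k + reg.a k * J / reg.Zm k) reg.Zm reg.Zm_pos) 0 m R ∧
      UpperPin Nf (QCDRegularisation.mk reg.a reg.a_pos reg.tendsto_a reg.β reg.L reg.tendsto_L
        (fun k => reg.mcrit k + reg.a k * J / reg.Zm k) reg.Zm reg.Zm_pos) 0 m R) →
    -- the residual: light-quark continuation of the body of `reg` to the translated tuples not above `M₀`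
    (∀ m : Fin Nf → ℝ, (∀ f, 0 < m f) → (∃ f, J + m f ≤ M₀) →
      ∃ (z shift : QCDField Nf → ℕ → ℝ) (T : OSData (QCDField Nf) 4),
      IsQCDAlong (reg.scheme (fun f => J + m f) z shift) T ∧ T.IsNontrivial QCDField.glue ∧
        T.IsNonGaussian QCDField.glue ∧ (∀ f g : Fin Nf, f ≠ g → T.IsNontrivial (QCDField.pseudoRe f g)) ∧
          ∃ Δ > 0, T.HasMassGap Δ ∧ (reg.scheme (fun f => J + m f) z shift).HasLatticeMassGap Δ) →
    ∀ m : Fin Nf → ℝ, (∀ f, 0 < m f) → ∃ (z shift : QCDField Nf → ℕ → ℝ) (T : OSData (QCDField Nf) 4),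
      IsQCDAlong ((QCDRegularisation.mk reg.a reg.a_pos reg.tendsto_a reg.β reg.L reg.tendsto_L
        (fun k => reg.mcrit k + reg.a k * J / reg.Zm k) reg.Zm reg.Zm_pos).scheme
        m z shift) T ∧ T.IsNontrivial QCDField.glue ∧ T.IsNonGaussian QCDField.glue ∧
        (∀ f g : Fin Nf, f ≠ g → T.IsNontrivial (QCDField.pseudoRe f g)) ∧
          ∃ Δ > 0, T.HasMassGap Δ ∧
            ((QCDRegularisation.mk reg.a reg.a_pos reg.tendsto_a reg.β reg.L reg.tendsto_L
        (fun k => reg.mcrit k + reg.a k * J / reg.Zm k) reg.Zm reg.Zm_pos).scheme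
              m z shift).HasLatticeMassGap Δ := by
  intro Nf _hNf reg _hMS _hAS _hbr M₀ _hM₀ _hpin hbody J _hpin' hlight m hm
  by_cases habove : ∀ f, M₀ < J + m f
  · exact body_recentre_of_above reg J hbody m habove
  · push Not at habove
    obtain ⟨z, shift, T, hQ, hN, hG, hP, Δ, hΔ, hT, hL⟩ := hlight m hm habove
    refine ⟨z, shift, T, ?_, hN, hG, hP, Δ, hΔ, hT, ?_⟩
    · rwa [recentre_scheme]
    · rwa [recentre_scheme]

end Summit.QuantumFields.QCD.Theorems.LightQuarkJumpLine

end
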